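import Literature.AlgebraicGeometry.HodgeTheory.KaehlerDatumFormTransport
import Literature.AlgebraicGeometry.HodgeTheory.RelativeHyperplaneClassHodgeRiemann
import Literature.AlgebraicGeometry.HodgeTheory.UniversalHypersurfaceFlatCoefficient
import Literature.AlgebraicGeometry.Motives.HodgeStructurePolarizationFiltrationOrthogonal
import Literature.AlgebraicGeometry.Motives.GeometricVHSPolarizedTransport
import Literature.AlgebraicGeometry.Motives.MumfordTateInvariantsDualForm
import HarnessLib

/-!
# The Hodge filtration of the TRANSPORTED Hodge structures of a projective family is self-orthogonal
# for ONE fixed form on the base fibre: `F^a(T^*H_t) = (F^{n+1-a}(T^*H_t))^{⊥}` for `Q_s`, middle degree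

Family `hodge`, layer `Literature/AlgebraicGeometry/HodgeTheory`; proof file (theorems only, no
definition, no named fact). Written by the prover seat `hodge-nonav-20241-p1` (g17, cell `hodge-nonav`)
for prover-Ax's programme «GRIFFITHS-SURFACES» (route `HodgeConjecture/CyclicUnitaryPowers`,
`--supports stmt-HodgeConjecture-19544`), brick **B5b-PACKAGING**: the hypothesis `hB1` of
`exists_subbundleFrames_of_weightTwo` (`HodgeFramesOfWeightTwo`).

Setting: `f : 𝒳 ⟶ S` cohomologically locally trivial over `U` (`transportFun` = parallel transport),
`s, t ∈ U` with smooth projective fibres of dimension `n`, a Hodge-symmetric model `A` of `X_t`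
(`A.hodgeStructure hX_t hA n` = the Hodge structure on `Hⁿ(X_t(ℂ); ℚ)`), a rational TRANSPORT
`T : Hⁿ(X_s; ℚ) ≃ Hⁿ(X_t; ℚ)` along a path class `γ` (`(T v) ⊗ 1 = γ_*(v ⊗ 1)`), and Kähler–rational
data `D_s`, `D_t` of the two fibres whose Kähler classes are restrictions of ONE global class `K` up
to a non-zero scalar on `X_s` (for the data of `exists_kaehlerRationalDatum_eq_map` attached to one
morphism `ε : 𝒳 ⟶ ℙᴺ` immersing the fibres this is automatic: `H²(ℙᴺ(ℂ); ℂ)` is a line).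

* `KaehlerRationalDatum.comapEquiv_form_baseChange_eq_mul_of_transport` — the complexified form of
  the transported polarization `(Q_t.comapEquiv T)` is `c · (Q_s)_ℂ` on `ℂ ⊗ Hⁿ(X_s; ℚ)`, `c ≠ 0`
  (`exists_cform_transportFun_eq_mul_middle`, B5b-geometric core, read through `form_baseChange` and
  the complexified transport `Θ ∘ T_ℂ = γ_* ∘ Θ`).
* **`mem_F_comapEquiv_iff_forall_form_baseChange_eq_zero_of_transport`** — for every `a`,
  `x ∈ F^a(T^*H_t) ↔ ∀ y ∈ F^{n+1-a}(T^*H_t), (Q_s)_ℂ(x, y) = 0`: the first Hodge–Riemann relation as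
  an EQUALITY (`Polarization.mem_F_iff_forall_form_eq_zero`, B2) for the transported polarization,
  divided by `c`.
* `mem_F_comapEquiv_iff_of_closedImmersions` — the same with `D_t`, `K`, `μ` produced internally from a
  morphism `ε : 𝒳 ⟶ ℙᴺ` whose restrictions to `X_s`, `X_t` are closed immersions and a base datum
  `D_s` with `D_s.Hη = (ι_s ≫ ε)^* c_s`.
* **`forall_mem_F_one_comapEquiv_iff_of_closedImmersions`** — SURFACES (`n = 2`), `a = 1`: VERBATIM
  the binder `hB1` of `exists_subbundleFrames_of_weightTwo` for `H t := (A t).hodgeStructure _ _ 2`,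
  `B := (D_s.form hX_s 2).baseChange ℂ`, the reference state `(t₁, T₁)` admissible from `s`
  (continuations along paths from `t₁` are transports from `s` by `transportFun_trans`); and
  `separatingRight_form_baseChange` — the binder `hB` (`Polarization.nondegenerate_baseChange`).

So of the inputs of `exists_subbundleFrames_of_weightTwo` for a projective family of surfaces only the
holomorphic frame `w₂` of `F² = H^{2,0}` (brick B4, relative residue forms) remains. Honest scope: a
packaging lemma; nothing here says HC or any rung is proved.

## References

* [VoisinHodgeI2002] C. Voisin, Hodge Theory and Complex Algebraic Geometry I, CUP 2002, §7.1.2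
  (first Hodge–Riemann relation; the period domain in the flag manifold `F^a = (F^{n+1-a})^⊥`),
  §9.2.1 (local systems and transport), §10.2.1 Thm. 10.3.
* [VoisinHodgeII2003] C. Voisin, Hodge Theory and Complex Algebraic Geometry II, CUP 2003, §3.1.2
  (the polarization is flat).
-/

noncomputable section

open CategoryTheory AlgebraicGeometry
open scoped TensorProduct

namespace Literature.AlgebraicGeometry.HodgeTheory

section HodgeTheory

open Literature.AlgebraicTopology.SingularHomology Literature.AlgebraicGeometry.Motives
open Literature.AlgebraicGeometry.Motives.HodgeStructure

variable {𝒳 S : SchemeOver ℂ} (f : 𝒳 ⟶ S) {U : Set (ComplexPoints S)}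
  (hU : IsCohomologicallyLocallyTrivialOn f U)

/-! ### §1 Complexified rational transports -/

/-- **A rational transport `T` along `γ`, complexified, IS the transport of complex classes**: if
`(T v) ⊗ 1 = γ_* (v ⊗ 1)` for all rational `v`, then `Θ (T ⊗ ℂ) y = γ_* (Θ y)` for every
`y ∈ ℂ ⊗_ℚ Hᵏ(X_s; ℚ)`, `Θ = ofRatClassBaseChange` (both sides are `ℂ`-linear and agree on pure
tensors). [cite: VoisinHodgeI2002, §9.2.1] -/
theorem ofRatClassBaseChange_baseChange_eq_transportFun_of_transport {k : ℕ} {s t : U}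
    (γ : Path.Homotopic.Quotient s t)
    (T : singularCohomology ℚ ℚ (ComplexPoints (fiberOver f s.1)) k ≃ₗ[ℚ]
      singularCohomology ℚ ℚ (ComplexPoints (fiberOver f t.1)) k)
    (hT : ∀ v, ofRatClass _ k (T v) = transportFun f k hU γ (ofRatClass _ k v))
    (y : ℂ ⊗[ℚ] singularCohomology ℚ ℚ (ComplexPoints (fiberOver f s.1)) k) :
    ofRatClassBaseChange (ComplexPoints (fiberOver f t.1)) k (T.toLinearMap.baseChange ℂ y) =
      transportFun f k hU γ (ofRatClassBaseChange (ComplexPoints (fiberOver f s.1)) k y) := by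
  induction y using TensorProduct.induction_on with
  | zero => rw [map_zero, map_zero, map_zero, ← zero_smul ℂ (0 : complexBetti (fiberOver f s.1) k),
      transportFun_smul, zero_smul]
  | tmul c v =>
    rw [LinearMap.baseChange_tmul, ofRatClassBaseChange_tmul, ofRatClassBaseChange_tmul,
      transportFun_smul, LinearEquiv.coe_coe, hT]
  | add x y hx hy => rw [map_add, map_add, hx, hy, map_add, transportFun_add]

/-- **Continuations of an admissible state are admissible**: if `(T₁ v) ⊗ 1 = δ₁_*(v ⊗ 1)` and
`(T v) ⊗ 1 = ε_*((T₁ v) ⊗ 1)` then `(T v) ⊗ 1 = (δ₁ · ε)_*(v ⊗ 1)` (`transportFun_trans`).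
[cite: VoisinHodgeI2002, §9.2.1] -/
theorem exists_transport_of_continuation {k : ℕ} {s t₁ t : U}
    {T₁ : singularCohomology ℚ ℚ (ComplexPoints (fiberOver f s.1)) k ≃ₗ[ℚ]
      singularCohomology ℚ ℚ (ComplexPoints (fiberOver f t₁.1)) k}
    (hT₁ : ∃ δ₁ : Path.Homotopic.Quotient s t₁,
      ∀ v, ofRatClass _ k (T₁ v) = transportFun f k hU δ₁ (ofRatClass _ k v))
    (ε : Path.Homotopic.Quotient t₁ t)
    (T : singularCohomology ℚ ℚ (ComplexPoints (fiberOver f s.1)) k ≃ₗ[ℚ]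
      singularCohomology ℚ ℚ (ComplexPoints (fiberOver f t.1)) k)
    (hT : ∀ v, ofRatClass _ k (T v) = transportFun f k hU ε (ofRatClass _ k (T₁ v))) :
    ∃ γ : Path.Homotopic.Quotient s t, ∀ v, ofRatClass _ k (T v) = transportFun f k hU γ (ofRatClass _ k v) := by
  obtain ⟨δ₁, hδ₁⟩ := hT₁
  exact ⟨δ₁.trans ε, fun v ↦ by rw [hT, hδ₁, transportFun_trans]⟩

/-! ### §2 The transported polarization has the base form up to a scalar; `F^a = (F^{n+1-a})^⊥` -/

namespace KaehlerRationalDatum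

/-- **The complexified form of the transported polarization `Q_t.comapEquiv T` is `c · (Q_s)_ℂ`,
`c ≠ 0`** (on `ℂ ⊗_ℚ Hⁿ(X_s; ℚ)`, middle degree): `(Q_t ∘ (T,T))_ℂ(x,y) = (Q_t)_ℂ(T_ℂ x, T_ℂ y)
= Q_{t,ℂ}(γ_* Θx, γ_* Θy) = c · Q_{s,ℂ}(Θx, Θy) = c · (Q_s)_ℂ(x, y)`.
[cite: VoisinHodgeII2003, §3.1.2] [cite: VoisinHodgeI2002, §7.1.2 and §9.2.1] -/
theorem comapEquiv_form_baseChange_eq_mul_of_transport {n : ℕ} {s t : U}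
    (hXs : IsSmoothProjective n (fiberOver f s.1)) (hXt : IsSmoothProjective n (fiberOver f t.1))
    (Ds : KaehlerRationalDatum n (fiberOver f s.1)) (Dt : KaehlerRationalDatum n (fiberOver f t.1))
    (K : complexBetti 𝒳 2) (μ : ℂ) (hμ : μ ≠ 0)
    (hKs : complexBetti.map (fiberι f s.1) 2 K = μ • Ds.Hη)
    (hKt : complexBetti.map (fiberι f t.1) 2 K = Dt.Hη)
    (A : HodgeModel n (fiberOver f t.1)) (hA : A.IsHodgeSymmetric)
    (γ : Path.Homotopic.Quotient s t)
    (T : singularCohomology ℚ ℚ (ComplexPoints (fiberOver f s.1)) n ≃ₗ[ℚ]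
      singularCohomology ℚ ℚ (ComplexPoints (fiberOver f t.1)) n)
    (hT : ∀ v, ofRatClass _ n (T v) = transportFun f n hU γ (ofRatClass _ n v)) :
    ∃ c : ℂ, c ≠ 0 ∧ ∀ x y : ℂ ⊗[ℚ] singularCohomology ℚ ℚ (ComplexPoints (fiberOver f s.1)) n,
      ((Dt.polarization hXt A hA n).comapEquiv T).form.baseChange ℂ x y =
        c * (Ds.form hXs n).baseChange ℂ x y := by
  obtain ⟨c, hc0, hc⟩ := Ds.exists_cform_transportFun_eq_mul_middle f hU hXs hXt Dt K μ hμ hKs hKt γ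
  refine ⟨c, hc0, fun x y ↦ ?_⟩
  change LinearMap.BilinForm.baseChange ℂ ((Dt.form hXt n).compl₁₂ T.toLinearMap T.toLinearMap) x y = _
  rw [baseChange_compl₁₂, Dt.form_baseChange hXt, Ds.form_baseChange hXs,
    ofRatClassBaseChange_baseChange_eq_transportFun_of_transport f hU γ T hT,
    ofRatClassBaseChange_baseChange_eq_transportFun_of_transport f hU γ T hT, hc]

/-- **`F^a(T^*H_t) = (F^{n+1-a}(T^*H_t))^{⊥}` for the FIXED form `(Q_s)_ℂ`** — middle degree `n` of
a family of smooth projective `n`-folds, any `a`, any rational transport `T` along a path class from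
`s` to `t`, granted one global class `K` restricting to the Kähler classes of `D_t` and, up to
`μ ≠ 0`, of `D_s`: the first Hodge–Riemann relation as an equality for the transported polarization
(`Polarization.mem_F_iff_forall_form_eq_zero`), whose complexified form is `c · (Q_s)_ℂ`, `c ≠ 0`.
[cite: VoisinHodgeI2002, §7.1.2 and §10.2.1 Thm. 10.3] [cite: VoisinHodgeII2003, §3.1.2] -/
theorem mem_F_comapEquiv_iff_forall_form_baseChange_eq_zero_of_transport {n : ℕ} {s t : U}
    (hXs : IsSmoothProjective n (fiberOver f s.1)) (hXt : IsSmoothProjective n (fiberOver f t.1))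
    (Ds : KaehlerRationalDatum n (fiberOver f s.1)) (Dt : KaehlerRationalDatum n (fiberOver f t.1))
    (K : complexBetti 𝒳 2) (μ : ℂ) (hμ : μ ≠ 0)
    (hKs : complexBetti.map (fiberι f s.1) 2 K = μ • Ds.Hη)
    (hKt : complexBetti.map (fiberι f t.1) 2 K = Dt.Hη)
    (A : HodgeModel n (fiberOver f t.1)) (hA : A.IsHodgeSymmetric)
    (γ : Path.Homotopic.Quotient s t)
    (T : singularCohomology ℚ ℚ (ComplexPoints (fiberOver f s.1)) n ≃ₗ[ℚ]
      singularCohomology ℚ ℚ (ComplexPoints (fiberOver f t.1)) n)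
    (hT : ∀ v, ofRatClass _ n (T v) = transportFun f n hU γ (ofRatClass _ n v))
    (a : ℤ) (x : ℂ ⊗[ℚ] singularCohomology ℚ ℚ (ComplexPoints (fiberOver f s.1)) n) :
    x ∈ ((A.hodgeStructure hXt hA n).comapEquiv T).F a ↔
      ∀ y ∈ ((A.hodgeStructure hXt hA n).comapEquiv T).F ((n : ℤ) + 1 - a),
        (Ds.form hXs n).baseChange ℂ x y = 0 := by
  obtain ⟨c, hc0, hc⟩ := Ds.comapEquiv_form_baseChange_eq_mul_of_transport f hU hXs hXt Dt K μ hμ hKs hKt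
    A hA γ T hT
  rw [((Dt.polarization hXt A hA n).comapEquiv T).mem_F_iff_forall_form_eq_zero a x]
  refine forall₂_congr fun y _ ↦ ?_
  rw [hc x y]
  exact ⟨fun h ↦ (mul_eq_zero.1 h).resolve_left hc0, fun h ↦ by rw [h, mul_zero]⟩

/-- **`(Q_s)_ℂ` is right-separating** (it is non-degenerate: `Polarization.nondegenerate_baseChange`
for the polarization `D_s.polarization` of the Hodge structure of any Hodge-symmetric model) — the
binder `hB` of `exists_subbundleFrames_of_weightTwo`. [cite: VoisinHodgeI2002, §7.1.2] -/
theorem separatingRight_form_baseChange {n : ℕ} {X : SchemeOver ℂ} (hX : IsSmoothProjective n X)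
    (D : KaehlerRationalDatum n X) (A : HodgeModel n X) (hA : A.IsHodgeSymmetric) (k : ℕ) :
    ((D.form hX k).baseChange ℂ).SeparatingRight :=
  ((D.polarization hX A hA k).nondegenerate_baseChange).2

end KaehlerRationalDatum

/-! ### §3 From one projective morphism of the total space -/

/-- **The Kähler class of a Kähler–rational datum of an `n`-fold, `1 ≤ n`, is non-zero**
(`η = η¹` and the powers `ηᵖ`, `1 ≤ p ≤ n`, of a Kähler class are non-zero, Voisin I Cor. 3.9).
[cite: VoisinHodgeI2002, §3.1.3 Cor. 3.9] -/
theorem KaehlerRationalDatum.Hη_ne_zero {n : ℕ} {X : SchemeOver ℂ} (hX : IsSmoothProjective n X)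
    (hn : 1 ≤ n) (D : KaehlerRationalDatum n X) : D.Hη ≠ 0 := by
  have h := D.isKaehlerClassVia.cupPowTwo_ne_zero hX D.isMultiplicative (p := 1) le_rfl hn
  rwa [cupPowTwo_one] at h

/-- Restriction to a fibre of a class pulled back along `ε : 𝒳 ⟶ ℙᴺ` is the pull-back along
`ι_t ≫ ε`. [folklore] -/
private theorem complexBetti_map_fiberι_comp_projective {N : ℕ} (ε : 𝒳 ⟶ projectiveSpace N ℂ) (t : ComplexPoints S)
    (k : ℕ) (c : complexBetti (projectiveSpace N ℂ) k) :
    complexBetti.map (fiberι f t) k (complexBetti.map ε k c) = complexBetti.map (fiberι f t ≫ ε) k c := by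
  rw [complexBetti.map_comp]
  rfl

/-- **`F^a(T^*H_t) = (F^{n+1-a})^{⊥}` for `(Q_s)_ℂ`, from ONE morphism `ε : 𝒳 ⟶ ℙᴺ` immersing the
fibres `X_s`, `X_t`** (`1 ≤ n`, `1 ≤ N`): with `D_s.Hη = (ι_s ≫ ε)^* c_s` and `D_t`, `c_t` from
`exists_kaehlerRationalDatum_eq_map hX_t (ι_t ≫ ε)`, the classes `c_s`, `c_t` lie on the line
`H²(ℙᴺ(ℂ); ℂ) = ℂ θ` with non-zero coefficients (Kähler classes are non-zero), so `K := ε^* c_t`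
restricts to `D_t.Hη` on `X_t` and to `(λ_t/λ_s) · D_s.Hη` on `X_s`, and §2 applies.
[cite: VoisinHodgeI2002, §7.1.2 and Thm. 7.10] [cite: VoisinHodgeII2003, §3.1.2] -/
theorem mem_F_comapEquiv_iff_of_closedImmersions {n : ℕ} (hn : 1 ≤ n) {N : ℕ} (hN : 1 ≤ N)
    (ε : 𝒳 ⟶ projectiveSpace N ℂ) {s t : U}
    (hXs : IsSmoothProjective n (fiberOver f s.1)) (hXt : IsSmoothProjective n (fiberOver f t.1))
    [IsClosedImmersion (fiberι f t.1 ≫ ε).left]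
    (Ds : KaehlerRationalDatum n (fiberOver f s.1)) (cs : complexBetti (projectiveSpace N ℂ) 2)
    (hDs : Ds.Hη = complexBetti.map (fiberι f s.1 ≫ ε) 2 cs)
    (A : HodgeModel n (fiberOver f t.1)) (hA : A.IsHodgeSymmetric)
    (γ : Path.Homotopic.Quotient s t)
    (T : singularCohomology ℚ ℚ (ComplexPoints (fiberOver f s.1)) n ≃ₗ[ℚ]
      singularCohomology ℚ ℚ (ComplexPoints (fiberOver f t.1)) n)
    (hT : ∀ v, ofRatClass _ n (T v) = transportFun f n hU γ (ofRatClass _ n v))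
    (a : ℤ) (x : ℂ ⊗[ℚ] singularCohomology ℚ ℚ (ComplexPoints (fiberOver f s.1)) n) :
    x ∈ ((A.hodgeStructure hXt hA n).comapEquiv T).F a ↔
      ∀ y ∈ ((A.hodgeStructure hXt hA n).comapEquiv T).F ((n : ℤ) + 1 - a),
        (Ds.form hXs n).baseChange ℂ x y = 0 := by
  -- the datum of `X_t` attached to `ι_t ≫ ε`
  obtain ⟨Dt, ct, hDt⟩ := exists_kaehlerRationalDatum_eq_map hXt (fiberι f t.1 ≫ ε)
  -- `H²(ℙᴺ(ℂ); ℂ)` is the line through `θ ⊗ 1`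
  obtain ⟨θ, hθ⟩ := exists_bettiCohomology_projectiveSpace_two_ne_zero N hN
  obtain ⟨ls, hls⟩ := exists_eq_smul_ofRatClass_projectiveSpace_two N hN hθ cs
  obtain ⟨lt, hlt⟩ := exists_eq_smul_ofRatClass_projectiveSpace_two N hN hθ ct
  have hls0 : ls ≠ 0 := by
    rintro rfl
    exact Ds.Hη_ne_zero hXs hn (by rw [hDs, hls, zero_smul, map_zero])
  have hlt0 : lt ≠ 0 := by
    rintro rfl
    exact Dt.Hη_ne_zero hXt hn (by rw [hDt, hlt, zero_smul, map_zero])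
  -- the global class `K := ε^* c_t`
  refine Ds.mem_F_comapEquiv_iff_forall_form_baseChange_eq_zero_of_transport f hU hXs hXt Dt
    (complexBetti.map ε 2 ct) (lt * ls⁻¹) (mul_ne_zero hlt0 (inv_ne_zero hls0)) ?_ ?_ A hA γ T hT a x
  · rw [complexBetti_map_fiberι_comp_projective, hDs, hlt, hls, map_smul, map_smul, smul_smul,
      inv_mul_cancel_right₀ hls0]
  · rw [complexBetti_map_fiberι_comp_projective, hDt]

/-! ### §4 Surfaces: the binders `hB1`, `hB` of `exists_subbundleFrames_of_weightTwo` -/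

/-- **B5b-PACKAGING — the binder `hB1` of `exists_subbundleFrames_of_weightTwo` for a projective
family of SURFACES.** For `f : 𝒳 ⟶ S` cohomologically locally trivial over `U` with smooth projective
fibres of dimension `2` over `U`, a morphism `ε : 𝒳 ⟶ ℙᴺ` (`1 ≤ N`) restricting to closed immersions
of the fibres over `U`, Hodge-symmetric models `A t`, a base point `s` with datum `D_s`,
`D_s.Hη = (ι_s ≫ ε)^* c_s`, and a reference state `(t₁, T₁)` admissible from `s`: along every
continuation `T` of `T₁` (inside any `W₀`), `x ∈ F¹(T^*H_t) ↔ ∀ y ∈ F²(T^*H_t), (Q_s)_ℂ(x, y) = 0` with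
`H_t = (A t).hodgeStructure _ _ 2`. VERBATIM the shape of `hB1` with `B := (D_s.form hX_s 2).baseChange ℂ`.
[cite: VoisinHodgeI2002, §7.1.2 and §10.2.1 Thm. 10.3] [cite: VoisinHodgeII2003, §3.1.2] -/
theorem forall_mem_F_one_comapEquiv_iff_of_closedImmersions {N : ℕ} (hN : 1 ≤ N)
    (ε : 𝒳 ⟶ projectiveSpace N ℂ)
    (hX : ∀ t : U, IsSmoothProjective 2 (fiberOver f t.1))
    (hε : ∀ t : U, IsClosedImmersion (fiberι f t.1 ≫ ε).left)
    (A : ∀ t : U, HodgeModel 2 (fiberOver f t.1)) (hA : ∀ t : U, (A t).IsHodgeSymmetric)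
    (s : U) (Ds : KaehlerRationalDatum 2 (fiberOver f s.1)) (cs : complexBetti (projectiveSpace N ℂ) 2)
    (hDs : Ds.Hη = complexBetti.map (fiberι f s.1 ≫ ε) 2 cs)
    {t₁ : U} {T₁ : singularCohomology ℚ ℚ (ComplexPoints (fiberOver f s.1)) 2 ≃ₗ[ℚ]
      singularCohomology ℚ ℚ (ComplexPoints (fiberOver f t₁.1)) 2}
    (hT₁ : ∃ δ₁ : Path.Homotopic.Quotient s t₁,
      ∀ v, ofRatClass _ 2 (T₁ v) = transportFun f 2 hU δ₁ (ofRatClass _ 2 v))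
    (W₀ : Set U) :
    ∀ t ∈ W₀, ∀ (ε' : Path t₁ t), (∀ r', ε' r' ∈ W₀) →
      ∀ (T : singularCohomology ℚ ℚ (ComplexPoints (fiberOver f s.1)) 2 ≃ₗ[ℚ]
        singularCohomology ℚ ℚ (ComplexPoints (fiberOver f t.1)) 2),
      (∀ v, ofRatClass _ 2 (T v) = transportFun f 2 hU ⟦ε'⟧ (ofRatClass _ 2 (T₁ v))) →
      ∀ x, x ∈ (((A t).hodgeStructure (hX t) (hA t) 2).comapEquiv T).F 1 ↔
        ∀ y ∈ (((A t).hodgeStructure (hX t) (hA t) 2).comapEquiv T).F 2,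
          (Ds.form (hX s) 2).baseChange ℂ x y = 0 := by
  intro t _ ε' _ T hT x
  obtain ⟨γ, hγ⟩ := exists_transport_of_continuation f hU hT₁ ⟦ε'⟧ T hT
  haveI := hε t
  have h := mem_F_comapEquiv_iff_of_closedImmersions f hU (n := 2) (by norm_num) hN ε (hX s) (hX t)
    Ds cs hDs (A t) (hA t) γ T hγ 1 x
  rwa [show ((2 : ℕ) : ℤ) + 1 - 1 = 2 by norm_num] at h

end HodgeTheory

end Literature.AlgebraicGeometry.HodgeTheory

end
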